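import Mathlib
import HarnessLib
import Summits.ABC.ABC.Theses.IneffectiveSubspace
import Literature.NumberTheory.DiophantineGeometry.AbcWave0

/-!
# Sketch — crux stmt-ABC-1649 (TowerFourSubLiouville), ideator 3, round 1

First lemmas of the idea card `defect-kummer-moving-roth` (signatures only; `sorry` bodies).
Namespace kept out of the route's; nothing here is a route item.
-/

namespace Summit.ABC.ABC.Cruxes.TowerFourSubLiouville.Ideator3

open Summit.ABC.ABC.Theses.IneffectiveSubspace

/-- `rad4 m = ∏ p ^ ⌈v_p(m)/4⌉` — the least value of `∏ xᵢ` over `x₁ x₂² x₃³ x₄⁴ = m`. -/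
noncomputable def rad4 (m : ℕ) : ℕ := m.factorization.prod fun p v => p ^ ((v + 3) / 4)

/-- fourth-power defect `d₄(m) = ∏_{4 ∤ v_p} p ^ (4 - v_p mod 4)` = least `d` with `d * m` a fourth power;
`rad4 m ^ 4 = m * defect4 m`. -/
noncomputable def defect4 (m : ℕ) : ℕ := m.factorization.prod fun p v => p ^ ((4 - v % 4) % 4)

/-- L0 (elementary, the hinge of the reformulation): every level-4 tower representation of `m`
has `∏ xᵢ ≥ rad4 m`, with equality attained. -/
theorem L0_rad4_le_prod (m : ℕ) (x : Fin 4 → ℕ) (hx : ∀ i, 0 < x i)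
    (hm : (∏ i, x i ^ (i.val + 1)) = m) : rad4 m ≤ ∏ i, x i := by
  sorry

theorem L0_rad4_attained (m : ℕ) (hm : 0 < m) :
    ∃ x : Fin 4 → ℕ, (∀ i, 0 < x i) ∧ (∏ i, x i ^ (i.val + 1)) = m ∧ (∏ i, x i) = rad4 m := by
  sorry

theorem L0_rad4_pow_four (m : ℕ) (hm : 0 < m) : rad4 m ^ 4 = m * defect4 m := by
  sorry

/-- L1 (exact reformulation of the crux): `∃ θ > 2` with `c^{θ-ε} ≪_ε abc·d₄(a)d₄(b)d₄(c)`. -/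
def DefectInequality : Prop :=
  ∃ θ : ℝ, 2 < θ ∧ ∀ ε : ℝ, 0 < ε → ∃ C : ℝ, 0 < C ∧ ∀ a b c : ℕ, 0 < a → 0 < b → a + b = c →
    Nat.Coprime a b →
      (c : ℝ) ^ (θ - ε) ≤ C * ((a * b * c * (defect4 a * defect4 b * defect4 c) : ℕ) : ℝ)

theorem L1_reformulation : TowerFourSubLiouville ↔ DefectInequality := by
  sorry

/-- L2 (transfer, C⁺): a uniform sub-Liouville inequality for the moving diagonal quartic family
`α Z⁴ − γ X⁴`, polynomial in the coefficients. `C⁺ → crux` (and conversely up to the exponents). -/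
def DiagonalQuarticSubLiouville : Prop :=
  ∃ η : ℝ, 0 < η ∧ ∃ K : ℝ, ∀ ε : ℝ, 0 < ε → ∃ C : ℝ, 0 < C ∧ ∀ α γ X Z : ℕ, 0 < α → 0 < γ →
    0 < X → 0 < Z → Nat.Coprime X Z → (α : ℤ) * Z ^ 4 ≠ (γ : ℤ) * X ^ 4 →
      (Z : ℝ) ^ (η - ε) ≤ C * ((α * γ : ℕ) : ℝ) ^ K * (|((α : ℤ) * Z ^ 4 - (γ : ℤ) * X ^ 4 : ℤ)| : ℝ)

theorem L2_transfer : DiagonalQuarticSubLiouville → TowerFourSubLiouville := by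
  sorry

/-- L3 (the provable partial — regime "fixed defect support"): for each finite set of primes `P`,
triples whose defects `d₄(a), d₄(c)` are supported on `P` satisfy the defect inequality with some
`η_P > 0`. Source: Roth's theorem with moving targets (Vojta 1996; Bombieri–Gubler Thm 6.5.2) with
`K = ℚ`, `S = {∞}`, `F = ℚ(ζ₈, ⁴√p : p ∈ P)`, targets `⁴√(d₄(a)/d₄(c))`, approximants `X/Z`. -/
def DefectInequalityOn (P : Finset ℕ) : Prop :=
  ∃ η : ℝ, 0 < η ∧ ∃ C : ℝ, 0 < C ∧ ∀ a b c : ℕ, 0 < a → 0 < b → b ≤ a → a + b = c →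
    Nat.Coprime a b → (defect4 a).primeFactors ⊆ P → (defect4 c).primeFactors ⊆ P →
      (c : ℝ) ^ η ≤ C * ((b * (defect4 a * defect4 b * defect4 c) : ℕ) : ℝ)

theorem L3_fixed_support (hRoth : Literature.NumberTheory.DiophantineGeometry.roth)
    (P : Finset ℕ) : DefectInequalityOn P := by
  sorry

/-- Effective Thue bound of Baker type for the diagonal quartic family, in the printed SHAPE of
Bugeaud–Győry (Acta Arith. 74 (1996)): every solution of `α Z⁴ − γ X⁴ = m ≠ 0` has
`log max(X,Z) ≤ C₀ · (αγ)^{K₀} · log(e|m| + αγ)`. Unproved in the tree (it follows from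
`Literature.NumberTheory.DiophantineGeometry.baker_wustholz` over the quartic fields); used as a
hypothesis only. -/
def EffectiveThueDiagonalQuartic : Prop :=
  ∃ C₀ K₀ : ℝ, 0 < C₀ ∧ 0 < K₀ ∧ ∀ α γ X Z : ℕ, 0 < α → 0 < γ → 0 < X → 0 < Z →
    (α : ℤ) * Z ^ 4 ≠ (γ : ℤ) * X ^ 4 →
      Real.log (max X Z : ℕ) ≤ C₀ * ((α * γ : ℕ) : ℝ) ^ K₀ *
        Real.log (Real.exp 1 * |((α : ℤ) * Z ^ 4 - (γ : ℤ) * X ^ 4 : ℤ)| + (α * γ : ℕ))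

/-- L4 (regime "polylog defects", effective): Baker-type Thue bounds settle every family with
`b · d₄(a) · d₄(c) ≤ (log c)^{δ₀}` for an absolute `δ₀ > 0` (e.g. any `δ₀ < 1/(K₀+1)`):
such triples are bounded. This is all the logarithmic-forms class gives here
(`Literature.Barriers.ABC.BakerMethodBounds`). -/
theorem L4_polylog_regime (hThue : EffectiveThueDiagonalQuartic) :
    ∃ δ₀ : ℝ, 0 < δ₀ ∧ ∃ C : ℝ, ∀ a b c : ℕ, 0 < a → 0 < b → b ≤ a → a + b = c →
      Nat.Coprime a b → ((b * (defect4 a * defect4 c) : ℕ) : ℝ) ≤ Real.log c ^ δ₀ → (c : ℝ) ≤ C := by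
  sorry

end Summit.ABC.ABC.Cruxes.TowerFourSubLiouville.Ideator3
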